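import Mathlib
import Summits.Ventures.PercRepro2.Defs
import Summits.Ventures.PercRepro2.Graph
import Summits.Ventures.PercRepro2.OneColourSwitch
import Summits.Ventures.PercRepro2.M9NoPocketDefs
import Summits.Ventures.PercRepro2.M9PocketProdPoint
import Summits.Ventures.PercRepro2.M9PocketProdWorlds

/-!
# The product fibre of a skeleton: the status of `d` and the monotonicity (blind cell
PercRepro2, p3 g39, 2026-08-29; `proofs/P3-POCKETRK.md` §8′ (ii)–(iv) and §10 (d): the
free-block extension, part 3)

Continuation of `M9PocketProdWorlds`.  At every point `φ S` of the product fibre `d` is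
`Y`-reached and not `W`-reached (`d_mem_K2_prod`, `d_notMem_M2_prod`): every point is a
`K`-only legal point.  **The monotonicity feeding `M9PocketProdHarris`**: a `Y`-path from `p`
at `φ S` lives in the outside and the switched blocks — its free edges stay open at `φ S'` for
`S ⊆ S'`, its edges at switched blocks are unchanged — so `p ~_Y q` is monotone in `S`
(`conn_prod_mono`); at `φ Sᶜ` the same edges are closed at `φ S`, so `p ~_Y q` at `φ Sᶜ`
gives `p ~_W q` at `φ S` (`conn_compl_prod_of_conn_compl`).  Own work; std axioms.
-/

namespace Summit.Ventures.PercRepro2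

namespace NoPocket

open Finset Classical OneColourSwitch SideSwitch

variable {V : Type*} {E : Type*} {ends : E → Sym2 V} {p q r s d : V} {ρ : Config E}
  {𝔉 : Finset (Finset V)} {R : Finset E}

section Status

variable (hdr : d ≠ r) (hds : d ≠ s) (hrs : within ends ({r, s} : Set V) = ∅)
  (hT : ∀ e, ends e ≠ s(d, r) ∧ ends e ≠ s(d, s))
  (hsep : sep2 ends p q r s ρ) (hD : DOne ends r s d ρ) (hK : d ∈ K2 ends r s ρ)
  (hB : ∀ x ∈ M2 (endsD ends d) r s ρ, x = r ∨ x = s)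
  (hR : ∀ e, e ∈ R ↔ e ∉ touches ends (cluster ends ρ d ∪ K2 (endsD ends d) r s ρ ∪
    M2 (endsD ends d) r s ρ))
  (h𝔉K : ∀ C ∈ 𝔉, (↑C : Set V) ⊆ K2 (endsD ends d) r s ρ)
  (h𝔉r : ∀ C ∈ 𝔉, r ∉ C) (h𝔉s : ∀ C ∈ 𝔉, s ∉ C)
  (h𝔉cl : ∀ C ∈ 𝔉, ClosedIn (endsD ends d) (sided (endsD ends d) r s ρ) (↑C : Set V))
  (h𝔉d : ∀ C ∈ 𝔉, ∀ e y, y ∈ C → ends e ≠ s(d, y))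
  (h𝔉pk : ∀ C ∈ 𝔉, ∀ e x y, ends e = s(x, y) → x ∈ C → y ∈ cluster ends ρ d →
    y ∈ C ∨ y = r ∨ y = s)
  (hdisj : ∀ C ∈ 𝔉, ∀ C' ∈ 𝔉, C ≠ C' → Disjoint C C')
  (S : Finset ({C // C ∈ 𝔉} ⊕ {e // e ∈ R}))

include hdr hds hrs hT hsep hK hB hR h𝔉K h𝔉r h𝔉s h𝔉cl h𝔉d in
/-- **`d` is `Y`-reached at every point of the product fibre**: through its `Y` edge into a
joined block, which is fixed. -/
lemma d_mem_K2_prod :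
    d ∈ K2 ends r s (flipTouch (endsD ends d)
      {x : V | ∃ c : {C // C ∈ 𝔉}, Sum.inl c ∈ S ∧ x ∈ c.1}
      (fun e => if h : e ∈ R then decide (Sum.inr ⟨e, h⟩ ∈ S) else ρ e)) := by
  obtain ⟨e, y, hey, he, hy⟩ := exists_open_edge_d_of_mem_K2 hdr hds hK
  have hnt : e ∉ touches (endsD ends d)
      {x : V | ∃ c : {C // C ∈ 𝔉}, Sum.inl c ∈ S ∧ x ∈ c.1} := by
    rintro ⟨z, hz, w, hzw⟩
    rw [endsD_of_mem (by rw [hey]; exact Sym2.mem_mk_left _ _), Sym2.eq_iff] at hzw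
    have hzd : z = d := by rcases hzw with ⟨h, _⟩ | ⟨_, h⟩ <;> exact h.symm
    exact not_mem_K2_endsD hdr hds ρ (hzd ▸ switched_subset_K2 h𝔉K S hz)
  have hnR : e ∉ R := fun h => (hR e).1 h
    ⟨d, Or.inl (Or.inl (mem_cluster_self ends ρ d)), y, hey⟩
  have hfix := prod_eq_fixed (ρ := ρ) S hnR hnt
  have hyK : y ∈ K2 (endsD ends d) r s (flipTouch (endsD ends d)
      {x : V | ∃ c : {C // C ∈ 𝔉}, Sum.inl c ∈ S ∧ x ∈ c.1}
      (fun e => if h : e ∈ R then decide (Sum.inr ⟨e, h⟩ ∈ S) else ρ e)) := by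
    rw [K2_endsD_prod hdr hds hrs hT hsep hB hR h𝔉K h𝔉r h𝔉s h𝔉cl S]
    refine ⟨hy, ?_⟩
    rintro ⟨c, _, hyc⟩
    exact h𝔉d c.1 c.2 e y hyc hey
  refine mem_K2_of_open (K2_endsD_subset_K2 _ hyK) ?_ (by rw [hey, Sym2.eq_swap])
  rw [hfix]; exact he

include hdr hds hrs hT hsep hB hR h𝔉K h𝔉r h𝔉s h𝔉cl h𝔉d in
/-- **`d` is not `W`-reached at any point of the product fibre.** -/
lemma d_notMem_M2_prod :
    d ∉ M2 ends r s (flipTouch (endsD ends d)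
      {x : V | ∃ c : {C // C ∈ 𝔉}, Sum.inl c ∈ S ∧ x ∈ c.1}
      (fun e => if h : e ∈ R then decide (Sum.inr ⟨e, h⟩ ∈ S) else ρ e)) := by
  intro h
  rcases M2_prod_subset hdr hds hrs hT hsep hB hR h𝔉K h𝔉r h𝔉s h𝔉cl h𝔉d S h with h' | h' | h'
  · exact hdr h'
  · exact hds h'
  · exact not_mem_K2_endsD hdr hds ρ (switched_subset_K2 h𝔉K S h')

omit hdr hds hrs hT hsep hK hB hR h𝔉K h𝔉r h𝔉s h𝔉cl h𝔉d h𝔉pk in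
include hdisj in
/-- A vertex of a block not in `S` is not switched (the blocks are disjoint). -/
lemma notMem_switched_of_mem_block {c : {C // C ∈ 𝔉}} (hc : Sum.inl c ∉ S) {x : V}
    (hx : x ∈ c.1) : x ∉ {x : V | ∃ c : {C // C ∈ 𝔉}, Sum.inl c ∈ S ∧ x ∈ c.1} := by
  rintro ⟨c', hc', hx'⟩
  by_cases hcc : c = c'
  · exact hc (hcc ▸ hc')
  · exact Finset.disjoint_left.1 (hdisj c.1 c.2 c'.1 c'.2 (fun h => hcc (Subtype.ext h))) hx hx'

include hdr hds hrs hT hsep hD hK hB hR h𝔉K h𝔉r h𝔉s h𝔉cl h𝔉d h𝔉pk in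
/-- **`p ~_Y q` is monotone in the index**: a `Y`-path from `p` at `φ S` runs through outside
vertices and switched blocks; its free edges stay open at `φ S'` for `S ⊆ S'`, its edges at
switched blocks are unchanged, and no other edge is open. -/
lemma conn_prod_mono {S' : Finset ({C // C ∈ 𝔉} ⊕ {e // e ∈ R})} (hSS : S ⊆ S')
    (h : Conn ends (flipTouch (endsD ends d)
      {x : V | ∃ c : {C // C ∈ 𝔉}, Sum.inl c ∈ S ∧ x ∈ c.1}
      (fun e => if h : e ∈ R then decide (Sum.inr ⟨e, h⟩ ∈ S) else ρ e)) p q) :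
    Conn ends (flipTouch (endsD ends d)
      {x : V | ∃ c : {C // C ∈ 𝔉}, Sum.inl c ∈ S' ∧ x ∈ c.1}
      (fun e => if h : e ∈ R then decide (Sum.inr ⟨e, h⟩ ∈ S') else ρ e)) p q := by
  set Sw := {x : V | ∃ c : {C // C ∈ 𝔉}, Sum.inl c ∈ S ∧ x ∈ c.1} with hSw
  set Sw' := {x : V | ∃ c : {C // C ∈ 𝔉}, Sum.inl c ∈ S' ∧ x ∈ c.1} with hSw'
  set ω := flipTouch (endsD ends d) Sw
    (fun e => if h : e ∈ R then decide (Sum.inr ⟨e, h⟩ ∈ S) else ρ e) with hω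
  set ω' := flipTouch (endsD ends d) Sw'
    (fun e => if h : e ∈ R then decide (Sum.inr ⟨e, h⟩ ∈ S') else ρ e) with hω'
  have hSwK := switched_subset_K2 (ρ := ρ) (r := r) (s := s) (d := d) (R := R) h𝔉K S
  have hsepD := sep2_endsD_of_sep2 (d := d) hsep
  have hSw_sub : Sw ⊆ Sw' := by rintro x ⟨c, hc, hx⟩; exact ⟨c, hSS hc, hx⟩
  -- `p` is outside: not sided, not `r, s`, not in the cluster of `d`
  have hpOut : p ∉ cluster ends ρ d ∪ K2 (endsD ends d) r s ρ ∪ M2 (endsD ends d) r s ρ := by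
    obtain ⟨⟨hpK, _⟩, _⟩ := sep2_iff.1 hsep
    obtain ⟨⟨hpK', _⟩, ⟨hpM', _⟩⟩ := sep2_iff.1 hsepD
    rintro ((h' | h') | h')
    · exact hpK (by
        rcases mem_K2_iff.1 hK with hc | hc
        · exact mem_K2_iff.2 (Or.inl (conn_trans hc h'))
        · exact mem_K2_iff.2 (Or.inr (conn_trans hc h')))
    · exact hpK' h'
    · exact hpM' h'
  have key : q ∈ {x | (x ∉ cluster ends ρ d ∪ K2 (endsD ends d) r s ρ ∪ M2 (endsD ends d) r s ρ
      ∨ x ∈ Sw) ∧ Conn ends ω' p x} := by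
    refine mem_of_conn_of_closed ?_ ⟨Or.inl hpOut, conn_refl _ _ _⟩ h
    rintro a ⟨ha, hac⟩ b hab
    obtain ⟨hne, e, he, hends⟩ := openGraph_adj.1 hab
    simp only [Set.mem_setOf_eq]
    rcases ha with haO | haSw
    · -- `a` outside
      by_cases hbSw : b ∈ Sw
      · -- an attachment edge into a switched block: flipped in both colourings
        refine ⟨Or.inr hbSw, conn_trans hac (conn_of_openAdj ⟨e, ?_, hends⟩)⟩
        have hbK : b ∈ K2 (endsD ends d) r s ρ := hSwK hbSw
        have hbd : b ≠ d := by rintro rfl; exact not_mem_K2_endsD hdr hds ρ hbK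
        have had : a ≠ d := fun h' => haO (Or.inl (Or.inl (h' ▸ mem_cluster_self ends ρ d)))
        have hde : d ∉ ends e := notMem_of_ends_ne hends had hbd
        have hnR : e ∉ R := fun h' => (hR e).1 h'
          ⟨b, Or.inl (Or.inr hbK), a, by rw [hends, Sym2.eq_swap]⟩
        have ht : e ∈ touches (endsD ends d) Sw :=
          ⟨b, hbSw, a, by rw [endsD_of_notMem hde, hends, Sym2.eq_swap]⟩
        have ht' : e ∈ touches (endsD ends d) Sw' :=
          ⟨b, hSw_sub hbSw, a, by rw [endsD_of_notMem hde, hends, Sym2.eq_swap]⟩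
        rw [hω', prod_eq_of_touches S' hnR ht']
        rw [hω, prod_eq_of_touches S hnR ht] at he
        exact he
      · by_cases hbU : b ∈ cluster ends ρ d ∪ K2 (endsD ends d) r s ρ ∪ M2 (endsD ends d) r s ρ
        · -- an edge from the outside into `U`, not into a switched block: `W` at `ρ`, fixed
          exfalso
          have hnR : e ∉ R := fun h' => (hR e).1 h' ⟨b, hbU, a, by rw [hends, Sym2.eq_swap]⟩
          have hnt : e ∉ touches (endsD ends d) Sw := by
            rintro ⟨z, hz, w, hzw⟩
            have hzK := hSwK hz
            have hzd : z ≠ d := by rintro rfl; exact not_mem_K2_endsD hdr hds ρ hzK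
            have hde : d ∉ ends e := by
              intro hde
              rw [endsD_of_mem hde, Sym2.eq_iff] at hzw
              rcases hzw with ⟨h1, _⟩ | ⟨_, h1⟩ <;> exact hzd h1.symm
            rw [endsD_of_notMem hde, hends, Sym2.eq_iff] at hzw
            rcases hzw with ⟨h1, _⟩ | ⟨_, h1⟩
            · exact haO (Or.inl (Or.inr (h1 ▸ hzK)))
            · exact hbSw (h1 ▸ hz)
          rw [hω, prod_eq_fixed S hnR hnt] at he
          have := edge_into_U_closed hdr hds hB hends haO hbU
          rw [this] at he
          exact absurd he (by decide)
        · -- a free edge: open at `S`, hence at `S'`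
          refine ⟨Or.inl hbU, conn_trans hac (conn_of_openAdj ⟨e, ?_, hends⟩)⟩
          have heR : e ∈ R := (hR e).2 (not_mem_touches_of_ends hends haO hbU)
          have hnt := notMem_touches_switched_of_mem_R hdr hds hR h𝔉K S heR
          have hnt' := notMem_touches_switched_of_mem_R hdr hds hR h𝔉K S' heR
          rw [hω', prod_eq_of_mem_R S' heR hnt']
          rw [hω, prod_eq_of_mem_R S heR hnt] at he
          simp only [decide_eq_true_eq] at he ⊢
          exact hSS he
    · -- `a` in a switched block `c`
      obtain ⟨c, hcS, hac'⟩ := haSw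
      have haK : a ∈ K2 (endsD ends d) r s ρ := hSwK ⟨c, hcS, hac'⟩
      have had : a ≠ d := by rintro rfl; exact not_mem_K2_endsD hdr hds ρ haK
      have hbd : b ≠ d := by
        rintro rfl
        exact h𝔉d c.1 c.2 e a hac' (by rw [hends, Sym2.eq_swap])
      have hde : d ∉ ends e := notMem_of_ends_ne hends had hbd
      have hnR : e ∉ R := fun h' => (hR e).1 h' ⟨a, Or.inl (Or.inr haK), b, hends⟩
      have ht : e ∈ touches (endsD ends d) Sw :=
        ⟨a, ⟨c, hcS, hac'⟩, b, by rw [endsD_of_notMem hde, hends]⟩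
      have ht' : e ∈ touches (endsD ends d) Sw' :=
        ⟨a, ⟨c, hSS hcS, hac'⟩, b, by rw [endsD_of_notMem hde, hends]⟩
      have hopen : ω' e = true := by
        rw [hω', prod_eq_of_touches S' hnR ht']
        rw [hω, prod_eq_of_touches S hnR ht] at he
        exact he
      refine ⟨?_, conn_trans hac (conn_of_openAdj ⟨e, hopen, hends⟩)⟩
      have hρe : ρ e = false := by
        rw [hω, prod_eq_of_touches S hnR ht] at he
        cases h' : ρ e
        · rfl
        · rw [h'] at he; exact absurd he (by decide)
      -- `b` is not `r` or `s`: a `W` root edge would put `a` on the `W`-side of `G − d`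
      have hbrs : ¬ (b = r ∨ b = s) := by
        intro hb
        have hbM : b ∈ M2 (endsD ends d) r s ρ := by
          rcases hb with rfl | rfl
          · exact r_mem_M2 b s ρ
          · exact s_mem_M2 r b ρ
        have haM := mem_M2_of_closed hbM hρe (by rw [endsD_of_notMem hde, hends, Sym2.eq_swap])
        rcases hB a haM with h' | h'
        · exact h𝔉r c.1 c.2 (h' ▸ hac')
        · exact h𝔉s c.1 c.2 (h' ▸ hac')
      by_cases hbc : b ∈ c.1
      · exact Or.inr ⟨c, hcS, hbc⟩
      · left
        rintro ((hbC | hbK) | hbM)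
        · rcases h𝔉pk c.1 c.2 e a b hends hac' hbC with h' | h' | h'
          · exact hbc h'
          · exact hbrs (Or.inl h')
          · exact hbrs (Or.inr h')
        · exact hbc (Finset.mem_coe.1 (h𝔉cl c.1 c.2 e a b (by rw [endsD_of_notMem hde, hends])
            (Finset.mem_coe.2 hac') ⟨Or.inl hbK, fun h' => hbrs (Or.inl h'),
              fun h' => hbrs (Or.inr h')⟩))
        · exact hbrs (hB b hbM)
  exact key.2

include hdr hds hrs hT hsep hD hK hB hR h𝔉K h𝔉r h𝔉s h𝔉cl h𝔉d h𝔉pk hdisj in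
/-- **The complement pairing**: a `Y`-path from `p` at `φ Sᶜ` runs through outside vertices and
the blocks of `Sᶜ`; every edge it uses is closed at `φ S` (a free edge of `Sᶜ`, or an edge
at a block of `Sᶜ`, which is `W` at `ρ` and unflipped at `φ S`). -/
lemma conn_compl_prod_of_conn_compl
    (h : Conn ends (flipTouch (endsD ends d)
      {x : V | ∃ c : {C // C ∈ 𝔉}, Sum.inl c ∈ Sᶜ ∧ x ∈ c.1}
      (fun e => if h : e ∈ R then decide (Sum.inr ⟨e, h⟩ ∈ Sᶜ) else ρ e)) p q) :
    Conn ends (OneColourSwitch.compl (flipTouch (endsD ends d)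
      {x : V | ∃ c : {C // C ∈ 𝔉}, Sum.inl c ∈ S ∧ x ∈ c.1}
      (fun e => if h : e ∈ R then decide (Sum.inr ⟨e, h⟩ ∈ S) else ρ e))) p q := by
  set Sw := {x : V | ∃ c : {C // C ∈ 𝔉}, Sum.inl c ∈ S ∧ x ∈ c.1} with hSw
  set Swc := {x : V | ∃ c : {C // C ∈ 𝔉}, Sum.inl c ∈ Sᶜ ∧ x ∈ c.1} with hSwc
  set ω := flipTouch (endsD ends d) Sw
    (fun e => if h : e ∈ R then decide (Sum.inr ⟨e, h⟩ ∈ S) else ρ e) with hω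
  set ωc := flipTouch (endsD ends d) Swc
    (fun e => if h : e ∈ R then decide (Sum.inr ⟨e, h⟩ ∈ Sᶜ) else ρ e) with hωc
  have hSwK := switched_subset_K2 (ρ := ρ) (r := r) (s := s) (d := d) (R := R) h𝔉K Sᶜ
  have hsepD := sep2_endsD_of_sep2 (d := d) hsep
  have hpOut : p ∉ cluster ends ρ d ∪ K2 (endsD ends d) r s ρ ∪ M2 (endsD ends d) r s ρ := by
    obtain ⟨⟨hpK, _⟩, _⟩ := sep2_iff.1 hsep
    obtain ⟨⟨hpK', _⟩, ⟨hpM', _⟩⟩ := sep2_iff.1 hsepD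
    rintro ((h' | h') | h')
    · exact hpK (by
        rcases mem_K2_iff.1 hK with hc | hc
        · exact mem_K2_iff.2 (Or.inl (conn_trans hc h'))
        · exact mem_K2_iff.2 (Or.inr (conn_trans hc h')))
    · exact hpK' h'
    · exact hpM' h'
  -- a vertex of a block of `Sᶜ` is not switched at `S`
  have hnotSw : ∀ {c : {C // C ∈ 𝔉}}, Sum.inl c ∈ Sᶜ → ∀ {x : V}, x ∈ c.1 → x ∉ Sw := by
    intro c hc x hx
    exact notMem_switched_of_mem_block hdisj S (Finset.mem_compl.1 hc) hx
  have key : q ∈ {x | (x ∉ cluster ends ρ d ∪ K2 (endsD ends d) r s ρ ∪ M2 (endsD ends d) r s ρ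
      ∨ x ∈ Swc) ∧ Conn ends (OneColourSwitch.compl ω) p x} := by
    refine mem_of_conn_of_closed ?_ ⟨Or.inl hpOut, conn_refl _ _ _⟩ h
    rintro a ⟨ha, hac⟩ b hab
    obtain ⟨hne, e, he, hends⟩ := openGraph_adj.1 hab
    simp only [Set.mem_setOf_eq]
    rcases ha with haO | haSw
    · -- `a` outside
      by_cases hbSw : b ∈ Swc
      · -- an attachment edge into a block of `Sᶜ`: `W` at `ρ`, unflipped at `S`
        refine ⟨Or.inr hbSw, conn_trans hac (conn_of_openAdj ⟨e, ?_, hends⟩)⟩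
        obtain ⟨c, hcS, hbc⟩ := hbSw
        have hbK : b ∈ K2 (endsD ends d) r s ρ := hSwK ⟨c, hcS, hbc⟩
        have hbd : b ≠ d := by rintro rfl; exact not_mem_K2_endsD hdr hds ρ hbK
        have had : a ≠ d := fun h' => haO (Or.inl (Or.inl (h' ▸ mem_cluster_self ends ρ d)))
        have hde : d ∉ ends e := notMem_of_ends_ne hends had hbd
        have hnR : e ∉ R := fun h' => (hR e).1 h'
          ⟨b, Or.inl (Or.inr hbK), a, by rw [hends, Sym2.eq_swap]⟩
        have htc : e ∈ touches (endsD ends d) Swc :=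
          ⟨b, ⟨c, hcS, hbc⟩, a, by rw [endsD_of_notMem hde, hends, Sym2.eq_swap]⟩
        have hnt : e ∉ touches (endsD ends d) Sw := by
          rintro ⟨z, hz, w, hzw⟩
          rw [endsD_of_notMem hde, hends, Sym2.eq_iff] at hzw
          rcases hzw with ⟨h1, _⟩ | ⟨_, h1⟩
          · exact haO (Or.inl (Or.inr (h1 ▸ switched_subset_K2 h𝔉K S hz)))
          · exact hnotSw hcS hbc (h1 ▸ hz)
        rw [hωc, prod_eq_of_touches Sᶜ hnR htc] at he
        have hρe : ρ e = false := by
          cases h' : ρ e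
          · rfl
          · rw [h'] at he; exact absurd he (by decide)
        show OneColourSwitch.compl ω e = true
        simp only [OneColourSwitch.compl]
        rw [hω, prod_eq_fixed S hnR hnt, hρe]
        rfl
      · by_cases hbU : b ∈ cluster ends ρ d ∪ K2 (endsD ends d) r s ρ ∪ M2 (endsD ends d) r s ρ
        · -- an edge from the outside into `U`, not into a block of `Sᶜ`: `W` at `ρ`, fixed
          exfalso
          have hnR : e ∉ R := fun h' => (hR e).1 h' ⟨b, hbU, a, by rw [hends, Sym2.eq_swap]⟩
          have hnt : e ∉ touches (endsD ends d) Swc := by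
            rintro ⟨z, hz, w, hzw⟩
            have hzK := hSwK hz
            have hzd : z ≠ d := by rintro rfl; exact not_mem_K2_endsD hdr hds ρ hzK
            have hde : d ∉ ends e := by
              intro hde
              rw [endsD_of_mem hde, Sym2.eq_iff] at hzw
              rcases hzw with ⟨h1, _⟩ | ⟨_, h1⟩ <;> exact hzd h1.symm
            rw [endsD_of_notMem hde, hends, Sym2.eq_iff] at hzw
            rcases hzw with ⟨h1, _⟩ | ⟨_, h1⟩
            · exact haO (Or.inl (Or.inr (h1 ▸ hzK)))
            · exact hbSw (h1 ▸ hz)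
          rw [hωc, prod_eq_fixed Sᶜ hnR hnt] at he
          have := edge_into_U_closed hdr hds hB hends haO hbU
          rw [this] at he
          exact absurd he (by decide)
        · -- a free edge of `Sᶜ`: closed at `S`
          refine ⟨Or.inl hbU, conn_trans hac (conn_of_openAdj ⟨e, ?_, hends⟩)⟩
          have heR : e ∈ R := (hR e).2 (not_mem_touches_of_ends hends haO hbU)
          have hnt := notMem_touches_switched_of_mem_R hdr hds hR h𝔉K S heR
          have hntc := notMem_touches_switched_of_mem_R hdr hds hR h𝔉K Sᶜ heR
          rw [hωc, prod_eq_of_mem_R Sᶜ heR hntc] at he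
          simp only [decide_eq_true_eq, Finset.mem_compl] at he
          show OneColourSwitch.compl ω e = true
          simp only [OneColourSwitch.compl]
          rw [hω, prod_eq_of_mem_R S heR hnt, decide_eq_false he]
          rfl
    · -- `a` in a block `c` of `Sᶜ`
      obtain ⟨c, hcS, hac'⟩ := haSw
      have haK : a ∈ K2 (endsD ends d) r s ρ := hSwK ⟨c, hcS, hac'⟩
      have had : a ≠ d := by rintro rfl; exact not_mem_K2_endsD hdr hds ρ haK
      have hbd : b ≠ d := by
        rintro rfl
        exact h𝔉d c.1 c.2 e a hac' (by rw [hends, Sym2.eq_swap])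
      have hde : d ∉ ends e := notMem_of_ends_ne hends had hbd
      have hnR : e ∉ R := fun h' => (hR e).1 h' ⟨a, Or.inl (Or.inr haK), b, hends⟩
      have htc : e ∈ touches (endsD ends d) Swc :=
        ⟨a, ⟨c, hcS, hac'⟩, b, by rw [endsD_of_notMem hde, hends]⟩
      rw [hωc, prod_eq_of_touches Sᶜ hnR htc] at he
      have hρe : ρ e = false := by
        cases h' : ρ e
        · rfl
        · rw [h'] at he; exact absurd he (by decide)
      -- `b` is not `r` or `s`
      have hbrs : ¬ (b = r ∨ b = s) := by
        intro hb
        have hbM : b ∈ M2 (endsD ends d) r s ρ := by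
          rcases hb with rfl | rfl
          · exact r_mem_M2 b s ρ
          · exact s_mem_M2 r b ρ
        have haM := mem_M2_of_closed hbM hρe (by rw [endsD_of_notMem hde, hends, Sym2.eq_swap])
        rcases hB a haM with h' | h'
        · exact h𝔉r c.1 c.2 (h' ▸ hac')
        · exact h𝔉s c.1 c.2 (h' ▸ hac')
      -- the edge is fixed at `S` (it touches no block of `S`), hence `W` there
      have hnt : e ∉ touches (endsD ends d) Sw := by
        rintro ⟨z, hz, w, hzw⟩
        rw [endsD_of_notMem hde, hends, Sym2.eq_iff] at hzw
        rcases hzw with ⟨h1, _⟩ | ⟨_, h1⟩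
        · exact hnotSw hcS hac' (h1 ▸ hz)
        · -- `b ∈ Sw`: `b` sided, adjacent to `a ∈ c`, hence in `c` — not switched at `S`
          have hbK : b ∈ K2 (endsD ends d) r s ρ := switched_subset_K2 h𝔉K S (h1 ▸ hz)
          have hbc : b ∈ c.1 := Finset.mem_coe.1 (h𝔉cl c.1 c.2 e a b
            (by rw [endsD_of_notMem hde, hends]) (Finset.mem_coe.2 hac')
            ⟨Or.inl hbK, fun h' => hbrs (Or.inl h'), fun h' => hbrs (Or.inr h')⟩)
          exact hnotSw hcS hbc (h1 ▸ hz)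
      have hclosed : OneColourSwitch.compl ω e = true := by
        simp only [OneColourSwitch.compl]
        rw [hω, prod_eq_fixed S hnR hnt, hρe]
        rfl
      refine ⟨?_, conn_trans hac (conn_of_openAdj ⟨e, hclosed, hends⟩)⟩
      by_cases hbc : b ∈ c.1
      · exact Or.inr ⟨c, hcS, hbc⟩
      · left
        rintro ((hbC | hbK) | hbM)
        · rcases h𝔉pk c.1 c.2 e a b hends hac' hbC with h' | h' | h'
          · exact hbc h'
          · exact hbrs (Or.inl h')
          · exact hbrs (Or.inr h')
        · exact hbc (Finset.mem_coe.1 (h𝔉cl c.1 c.2 e a b (by rw [endsD_of_notMem hde, hends])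
            (Finset.mem_coe.2 hac') ⟨Or.inl hbK, fun h' => hbrs (Or.inl h'),
              fun h' => hbrs (Or.inr h')⟩))
        · exact hbrs (hB b hbM)
  exact key.2

end Status

end NoPocket

end Summit.Ventures.PercRepro2
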